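import Mathlib.LinearAlgebra.Matrix.Permanent
import HarnessLib

/-!
# The permanent modulo `2^k` in polynomial time, I: Valiant's elimination as a list program

L. G. Valiant, *The complexity of computing the permanent*, TCS 8 (1979), Thm. 3: "for any
integer `k` the permanent of an integer matrix mod `2^k` can be computed in `O(n^{4k-3})` steps".
The proof (loc. cit. pp. 198–199) generalises Gaussian elimination: adding `d` times row `p` to
row `a` changes the permanent by `d · perm(A″)`, where `A″` is `A` with row `a` replaced by row `p`;
`A″` has two equal rows, so its permanent is even — precisely
`perm(A″) = 2 · Σ_{b < b″} q_b q_{b″} · perm(A″ minus rows a, p and columns b, b″)` (`q` = row `p`),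
which modulo `2^k` needs the `(n-2)`-minors only modulo `2^(k-1)`. Clearing a column with an odd
pivot this way and expanding along it reduces `n` by one at the cost of `O(n³)` permanents modulo
`2^(k-1)`; a column without an odd entry expands directly into `n` permanents modulo `2^(k-1)` with
an explicit factor `2`. Induction on `k` (the base `k = 0` is arithmetic modulo `1`).

This file writes that procedure as a TOTAL FUNCTIONAL PROGRAM on lists of rows of natural numbers
(arithmetic reduced modulo `N = 2^k` throughout), in the style of
`Literature/LinearAlgebra/Matrix/BerkowitzAlgorithm.lean`, so that (II) its correctness
(`PermanentModTwoPowCorrect.lean`: `pm k (rows M) = M.permanent % 2 ^ k`) and (III) its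
polynomial running time on codes (`Literature/Computability/Complexity/PermanentModTwoPowFP.lean`,
the typed `FP` algebra `CodeFP`) can be proved about the same object. Only definitions and their
unfolding lemmas live here.

* `addRow N d r q` — the row `r + d·q` reduced mod `N`; `colMinor2 b b' L` — delete column `b`, then
  column `b'` (in the new indexing) from every row; `pairSum q f` — `Σ_{b ≤ b'} q_b · q_{b'+1} · f b b'`
  (the unordered column pairs `b < b'+1`); `firstOdd l` — index of the first odd entry.
* `elim K prev q u done todo corr` — the elimination below the pivot row `q` (pivot `q₀`, `u` an
  inverse of `q₀` mod `2^K`): each remaining row `r` is replaced by `r + d·q`, `d ≡ -r₀·u`, and the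
  correction `-2·d·X` is accumulated, `X = pairSum q (perm mod 2^(K-1) of the (n-2)-minors of the
  CURRENT matrix)` computed by the previous level `prev`.
* `stage K prev (B, μ, acc)` — one column: invariant `perm(A) ≡ μ·perm(B) + acc (mod 2^K)`.
* `pm K L` — the permanent modulo `2^K` of the square list matrix `L` (by recursion on `K`, a fold
  of `stage K (pm (K-1))` over as many stages as there are rows).

## References

* [Valiant1979] L. G. Valiant, *The complexity of computing the permanent*, Theoret. Comput. Sci.
  8 (1979) 189–201, Thm. 3 and its proof (pp. 198–199).
-/

namespace Literature.LinearAlgebra.Matrix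

namespace PermMod2

/-! ### Row and column primitives -/

/-- The row `r + d·q`, entries reduced modulo `N`. [cite: Valiant1979, Thm. 3 (proof)] -/
def addRow (N d : ℕ) (r q : List ℕ) : List ℕ :=
  List.zipWith (fun x y => (x + d * y) % N) r q

/-- Delete column `b`, then column `b'` (in the new indexing), from every row: the columns kept are
`b.succAbove ∘ b'.succAbove`. [folklore] -/
def colMinor2 (b b' : ℕ) (L : List (List ℕ)) : List (List ℕ) :=
  L.map fun r => (r.eraseIdx b).eraseIdx b'

/-- Delete row `a` and column `0`. [folklore] -/
def minor0 (a : ℕ) (L : List (List ℕ)) : List (List ℕ) :=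
  (L.eraseIdx a).map List.tail

/-- `Σ_{b < |q|} Σ_{b' < |q|-1} [b ≤ b'] · q_b · q_{b'+1} · f b b'` — the sum over unordered column
pairs `{b, b'+1}`, `b < b'+1`, indexed as in `Fin.succAbove`. [cite: Valiant1979, Thm. 3 (proof)] -/
def pairSum (q : List ℕ) (f : ℕ → ℕ → ℕ) : ℕ :=
  ((List.range q.length).map fun b =>
    ((List.range (q.length - 1)).map fun b' =>
      if b ≤ b' then q.getD b 0 * q.getD (b' + 1) 0 * f b b' else 0).sum).sum

/-- Index of the first odd entry of a list, if any. [folklore] -/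
def firstOdd (l : List ℕ) : Option ℕ :=
  l.findIdx? fun x => x % 2 == 1

/-! ### Elimination below an odd pivot -/

/-- **Elimination with corrections.** Context: level `K` (modulus `N = 2^K`), the previous level
`prev` (intended: permanent mod `2^(K-1)`), the pivot row `q` (kept as row `0`), an inverse `u` of
`q₀` modulo `N`. State: the rows already reduced (`done`, in order), the rows still to do (`todo`),
the accumulated correction `corr`. Step on `r :: rest`: `d = -r₀·u mod N`;
`X = pairSum q (b b' ↦ prev (colMinor2 b b' (done ++ rest)))` (the minors of the CURRENT matrix
`q :: done ++ r :: rest` avoiding rows `q`, `r`); new row `addRow N d r q` (its column-`0` entry is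
`0`); `corr += -2·d·X mod N`. [cite: Valiant1979, Thm. 3 (proof)] -/
def elim (K : ℕ) (prev : List (List ℕ) → ℕ) (q : List ℕ) (u : ℕ) :
    List (List ℕ) → List (List ℕ) → ℕ → List (List ℕ) × ℕ
  | done, [], corr => (done, corr)
  | done, r :: rest, corr =>
    let N := 2 ^ K
    let d := (N - r.headD 0 * u % N) % N
    let X := pairSum q fun b b' => prev (colMinor2 b b' (done ++ rest))
    elim K prev q u (done ++ [addRow N d r q]) rest ((corr + (N - 2 * d * X % N)) % N)

/-! ### One column stage and the main recursion -/

/-- The inverse of an odd `c` modulo `2^K`: `c^(2^(K-1) - 1)` (Euler: `φ(2^K) = 2^(K-1)`). [folklore] -/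
def oddInv (K c : ℕ) : ℕ :=
  c ^ (2 ^ (K - 1) - 1) % 2 ^ K

/-- The contribution of a column without odd entries: `2 · Σ_a (c_a / 2) · prev (minor0 a B)`
modulo `2^K` (Laplace along column `0`; every `c_a` is even). [cite: Valiant1979, Thm. 3 (proof)] -/
def evenCorr (K : ℕ) (prev : List (List ℕ) → ℕ) (B : List (List ℕ)) : ℕ :=
  2 * ((List.range B.length).map fun a => (B.getD a []).headD 0 / 2 * prev (minor0 a B)).sum % 2 ^ K

/-- **One stage** on the state `(B, μ, acc)` (invariant: `perm(A) ≡ μ·perm(B) + acc (mod 2^K)`,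
`B` square with entries `< 2^K`). Empty `B`: nothing to do. No odd entry in column `0`: the whole
permanent of `B` is `evenCorr` modulo `2^K`; continue with the empty matrix. Otherwise move the
first row `p` with odd `c = B p 0` to the front (the permanent is invariant), eliminate below it,
and continue with the minor at `(0, 0)` of the eliminated matrix, multiplier `μ·c`, and the
corrections added to `acc`. [cite: Valiant1979, Thm. 3 (proof)] -/
def stage (K : ℕ) (prev : List (List ℕ) → ℕ) (st : List (List ℕ) × ℕ × ℕ) :
    List (List ℕ) × ℕ × ℕ :=
  match st with
  | ([], _, _) => st
  | (B, μ, acc) =>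
    match firstOdd (B.map fun r => r.headD 0) with
    | none => ([], 0, (acc + μ * evenCorr K prev B) % 2 ^ K)
    | some p =>
      let q := B.getD p []
      let c := q.headD 0
      let E := elim K prev q (oddInv K c) [] (B.eraseIdx p) 0
      (E.1.map List.tail, μ * c % 2 ^ K, (acc + μ * E.2) % 2 ^ K)

/-- All stages of level `K` on a square list matrix `L` (entries first reduced modulo `2^K`): as
many stages as rows, from `(L, 1, 0)`. [cite: Valiant1979, Thm. 3 (proof)] -/
def stages (K : ℕ) (prev : List (List ℕ) → ℕ) (L : List (List ℕ)) : List (List ℕ) × ℕ × ℕ :=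
  (List.range L.length).foldl (fun st _ => stage K prev st)
    (L.map fun r => r.map fun x => x % 2 ^ K, 1, 0)

/-- **Valiant's algorithm: the permanent modulo `2^K`** of a square matrix of naturals given by its
list of rows (`PermanentModTwoPowCorrect.pm_rows : pm K (rows M) = M.permanent % 2 ^ K`). Level `0`
is arithmetic modulo `1`; level `K+1` runs the stages with level `K` for the minors and returns
`μ + acc` (the final `B` is empty, `perm [] = 1`). [cite: Valiant1979, Thm. 3] -/
def pm : ℕ → List (List ℕ) → ℕ
  | 0, _ => 0
  | K + 1, L =>
    let st := stages (K + 1) (pm K) L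
    (st.2.1 + st.2.2) % 2 ^ (K + 1)

/-! ### Unfolding lemmas -/

/-- `elim` on an exhausted work list. [folklore] -/
@[simp] theorem elim_nil (K : ℕ) (prev : List (List ℕ) → ℕ) (q : List ℕ) (u : ℕ)
    (done : List (List ℕ)) (corr : ℕ) : elim K prev q u done [] corr = (done, corr) := rfl

/-- One step of `elim`. [folklore] -/
theorem elim_cons (K : ℕ) (prev : List (List ℕ) → ℕ) (q : List ℕ) (u : ℕ)
    (done : List (List ℕ)) (r : List ℕ) (rest : List (List ℕ)) (corr : ℕ) :
    elim K prev q u done (r :: rest) corr =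
      elim K prev q u (done ++ [addRow (2 ^ K) ((2 ^ K - r.headD 0 * u % 2 ^ K) % 2 ^ K) r q]) rest
        ((corr + (2 ^ K - 2 * ((2 ^ K - r.headD 0 * u % 2 ^ K) % 2 ^ K) *
          pairSum q (fun b b' => prev (colMinor2 b b' (done ++ rest))) % 2 ^ K)) % 2 ^ K) := rfl

/-- `stage` on the empty matrix. [folklore] -/
@[simp] theorem stage_nil (K : ℕ) (prev : List (List ℕ) → ℕ) (μ acc : ℕ) :
    stage K prev ([], μ, acc) = ([], μ, acc) := rfl

/-- `stage` on a nonempty matrix. [folklore] -/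
theorem stage_cons (K : ℕ) (prev : List (List ℕ) → ℕ) (r : List ℕ) (B : List (List ℕ)) (μ acc : ℕ) :
    stage K prev (r :: B, μ, acc) =
      match firstOdd ((r :: B).map fun r => r.headD 0) with
      | none => ([], 0, (acc + μ * evenCorr K prev (r :: B)) % 2 ^ K)
      | some p =>
        (((elim K prev ((r :: B).getD p []) (oddInv K (((r :: B).getD p []).headD 0)) []
            ((r :: B).eraseIdx p) 0).1.map List.tail),
          μ * ((r :: B).getD p []).headD 0 % 2 ^ K,
          (acc + μ * (elim K prev ((r :: B).getD p []) (oddInv K (((r :: B).getD p []).headD 0)) []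
            ((r :: B).eraseIdx p) 0).2) % 2 ^ K) := rfl

/-- Level `0`. [folklore] -/
@[simp] theorem pm_zero (L : List (List ℕ)) : pm 0 L = 0 := rfl

/-- Level `K+1`. [folklore] -/
theorem pm_succ (K : ℕ) (L : List (List ℕ)) :
    pm (K + 1) L = ((stages (K + 1) (pm K) L).2.1 + (stages (K + 1) (pm K) L).2.2) % 2 ^ (K + 1) := rfl

/-- `pm K L < 2^K` for `K ≥ 1` (and `pm 0 L = 0`): the output is a residue. [folklore] -/
theorem pm_lt_two_pow (K : ℕ) (L : List (List ℕ)) : pm K L < 2 ^ K := by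
  cases K with
  | zero => simp
  | succ K => rw [pm_succ]; exact Nat.mod_lt _ (Nat.two_pow_pos _)

end PermMod2

end Literature.LinearAlgebra.Matrix
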